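import Mathlib
import Summits.MatrixMultiplication.Statement
import Summits.MatrixMultiplication.MatrixMultiplication.Theorems.GraphEquationsInitialIdealRung

/-!
# Derivations on the graph equations: `Ψ` is an isomorphism, polar derivatives, the derivation `D_μ`
(M15a; cell `decomp-mm`, lens-5 g28 — infrastructure for kernel-field DEFLATION, see
`GraphEquationsPolarLemma`, `GraphEquationsDeflation`)

Helper kernel beneath the attacked crux `MultiplicityReduction` (stmt-MatrixMultiplication-27806) of
route `GraphEquations`, line `purisplit`, rung `K = 2` of BOP′.  Sorry-free content:

* `liftF_substF`, `substF_injective` — `Ψ : G(a,b;F) ↦ G(a,b;c−ab)` (M13 `substF`) is a ring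
  ISOMORPHISM `ℂ[A,B][F] ≅ ℂ[A,B,C]` with inverse `liftF`; `eval_graphPoint_substF`;
  `substF_mem_graphIdeal_iff : Ψ(G) ∈ I ↔ G₀ = 0`.
* `polarDeriv γ P = Σ_q γ_q ∂P/∂X_q` and its calculus: Leibniz, `map_polarDeriv`,
  `homogeneousComponent_polarDeriv` (the polar LOWERS DEGREE BY ONE, componentwise),
  `IsHomogeneous.polarDeriv`, `eval_polarDeriv_of_isHomogeneous_one : (D_γ ℓ)(x) = ℓ(γ)`,
  `eval_polarDeriv_comm : (D_γ P)(x) = (D_x P)(γ)` for quadrics (symmetry of second derivatives).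
* `derivC μ u = Σ_q μ_q(a,b) ∂u/∂c_q` — the DERIVATION along a coefficient field
  `μ : (a,b) ↦ ℂ^{n×n}`; `substF_polarDeriv : Ψ ∘ D_μ^F = D_μ ∘ Ψ` (under `Ψ` it is the polar in the
  fibre variables `F`); the KERNEL-FIELD CRITERION
  `derivC_mem_graphIdeal_iff : D_μ u ∈ I ↔ Σ_q μ_q · coeff_{F_q}(Ψ⁻¹ u) = 0 in ℂ[A,B]`;
  `derivC_mem_span` (`D_μ` maps `span S` into `span S'` once `S ∪ D_μ S ⊆ S'`).

Sources: Leykin–Verschelde–Zhao 2006 [doi:10.1016/j.tcs.2006.02.018] (deflation operator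
`F ↦ (F, JF·λ)`); BCS97 §7.1.  No sorry.
-/

set_option linter.dupNamespace false

noncomputable section

open scoped BigOperators

namespace Summit.MatrixMultiplication.MatrixMultiplication.Theorems.GraphEquations

open MvPolynomial
open Literature.Computability.AlgebraicComplexity

variable {n : ℕ}

/-! ## `Ψ : ℂ[A,B][F] → ℂ[A,B,C]` is an isomorphism -/

/-- `liftF ∘ Ψ = id`: together with `substF_liftF` (M13), `Ψ` is a ring isomorphism with inverse
`liftF`. -/
theorem liftF_substF (G : FPoly n) : liftF n (substF n G) = G := by
  have hC : ∀ g : MvPolynomial (MatMulVars n) ℂ, liftF n (liftAB n g) = C g := fun g => by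
    induction g using MvPolynomial.induction_on with
    | C c => simp [liftF]
    | add p q hp hq => rw [map_add, map_add, hp, hq, map_add]
    | mul_X p v hp => rw [map_mul, map_mul, hp, liftAB_X, map_mul]; simp [liftF]
  have h : ((liftF n : MvPolynomial (GraphVars n) ℂ →+* FPoly n).comp (substF n)) = RingHom.id _ := by
    refine ringHom_ext (fun g => ?_) (fun q => ?_)
    · simpa using hC g
    · simp [liftF, generator, map_sum]
  exact RingHom.congr_fun h G

/-- `Ψ` is injective. -/
theorem substF_injective : Function.Injective (substF n) := fun G H h => by
  rw [← liftF_substF G, ← liftF_substF H, h]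

/-- Evaluating `G(a,b;f)` at the graph point over `y` returns the `F`-constant term at `y`:
`Ψ(G)(y, y_A y_B) = G_0(y)`. -/
theorem eval_graphPoint_substF (y : MatMulVars n → ℂ) (G : FPoly n) :
    eval (graphPoint y) (substF n G) = eval y (constantCoeff G) := by
  have h : (eval (graphPoint y)).comp (substF n) =
      (eval y).comp (constantCoeff : FPoly n →+* MvPolynomial (MatMulVars n) ℂ) := by
    refine ringHom_ext (fun g => ?_) (fun q => ?_)
    · simp only [RingHom.comp_apply, substF_C, constantCoeff_C]
      rw [liftAB, AlgHom.toRingHom_eq_coe, RingHom.coe_coe, eval_rename]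
      rfl
    · simp [generator, graphPoint]
  exact RingHom.congr_fun h G

/-- Elements of `I` vanish on the graph. -/
theorem eval_eq_zero_of_mem_graphIdeal {u : MvPolynomial (GraphVars n) ℂ} (hu : u ∈ graphIdeal n)
    {x : GraphVars n → ℂ} (hx : x ∈ mmGraph n) : eval x u = 0 := by
  rw [← RingHom.mem_ker]
  refine (Ideal.span_le.mpr ?_) hu
  rintro _ ⟨q, rfl⟩
  rw [SetLike.mem_coe, RingHom.mem_ker, ← graphPoint_eq_of_mem hx]
  simp [generator, graphPoint]

/-- **`Ψ(G) ∈ I ⇔ G_0 = 0`**: the `I`-adic order of `G(a,b;f)` is positive iff the `F`-constant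
term vanishes. -/
theorem substF_mem_graphIdeal_iff (G : FPoly n) : substF n G ∈ graphIdeal n ↔ constantCoeff G = 0 := by
  constructor
  · intro h
    have h0 := homogeneousComponent_zero_liftF_eq_zero
      (fun x hx => eval_eq_zero_of_mem_graphIdeal h hx)
    rw [liftF_substF, homogeneousComponent_zero, ← constantCoeff_eq] at h0
    simpa using congrArg constantCoeff h0
  · intro h
    refine mem_graphIdeal_of_vanishing fun x hx => ?_
    rw [← graphPoint_eq_of_mem hx, eval_graphPoint_substF, h, map_zero]

/-! ## Directional derivatives in the fibre variables -/

/-- The POLAR (directional) derivative `D_γ P = Σ_q γ_q ∂P/∂X_q` of `P ∈ R[X_σ]` along a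
coefficient vector `γ ∈ R^σ`. -/
def polarDeriv {σ R : Type*} [Fintype σ] [CommSemiring R] (γ : σ → R) (P : MvPolynomial σ R) :
    MvPolynomial σ R :=
  ∑ q, C (γ q) * pderiv q P

section polar

variable {σ R : Type*} [CommSemiring R]

/-- `homogeneousComponent` commutes with `∂/∂X_q` up to the degree shift. -/
theorem homogeneousComponent_pderiv (j : ℕ) (q : σ) (G : MvPolynomial σ R) :
    homogeneousComponent j (pderiv q G) = pderiv q (homogeneousComponent (j + 1) G) := by
  classical
  ext d
  rw [coeff_homogeneousComponent, coeff_pderiv, coeff_pderiv, coeff_homogeneousComponent]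
  have hdeg : (d + Finsupp.single q 1).degree = d.degree + 1 := by
    rw [map_add, Finsupp.degree_single]
  by_cases h : d.degree = j
  · rw [if_pos h, if_pos (by rw [hdeg, h])]
  · rw [if_neg h, if_neg (by rw [hdeg]; omega), zero_mul]

/-- A form of degree `0` is a constant. -/
theorem eq_C_of_isHomogeneous_zero {p : MvPolynomial σ R} (h : p.IsHomogeneous 0) : p = C (coeff 0 p) := by
  rwa [← totalDegree_zero_iff_isHomogeneous, totalDegree_eq_zero_iff_eq_C] at h

/-- The partial derivatives of a linear form are its coefficients. -/
theorem pderiv_eq_C_of_isHomogeneous_one {ℓ : MvPolynomial σ R} (h : ℓ.IsHomogeneous 1) (q : σ) :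
    pderiv q ℓ = C (coeff (Finsupp.single q 1) ℓ) := by
  have h0 := eq_C_of_isHomogeneous_zero (h.pderiv (i := q))
  rw [h0, coeff_pderiv]
  simp

/-- A form of positive degree vanishes at the origin. -/
theorem eval_zero_of_isHomogeneous {P : MvPolynomial σ R} {m : ℕ} (hP : P.IsHomogeneous m) (hm : m ≠ 0) :
    eval 0 P = 0 := by
  rw [MvPolynomial.eval_zero, constantCoeff_eq]
  exact hP.coeff_eq_zero (by rw [map_zero]; exact Ne.symm hm)

variable [Fintype σ]

/-- `D_γ` kills constants. -/
@[simp] theorem polarDeriv_C (γ : σ → R) (a : R) : polarDeriv γ (C a : MvPolynomial σ R) = 0 := by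
  simp [polarDeriv]

/-- `D_γ 0 = 0`. -/
@[simp] theorem polarDeriv_zero (γ : σ → R) : polarDeriv γ (0 : MvPolynomial σ R) = 0 := by
  simp [polarDeriv]

/-- `D_γ X_q = γ_q`. -/
theorem polarDeriv_X [DecidableEq σ] (γ : σ → R) (q : σ) :
    polarDeriv γ (X q : MvPolynomial σ R) = C (γ q) := by
  simp [polarDeriv, pderiv_X, Pi.single_apply]

/-- `D_γ` is additive. -/
theorem polarDeriv_add (γ : σ → R) (P Q : MvPolynomial σ R) :
    polarDeriv γ (P + Q) = polarDeriv γ P + polarDeriv γ Q := by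
  simp [polarDeriv, mul_add, Finset.sum_add_distrib]

/-- Leibniz rule for `D_γ`. -/
theorem polarDeriv_mul (γ : σ → R) (P Q : MvPolynomial σ R) :
    polarDeriv γ (P * Q) = polarDeriv γ P * Q + P * polarDeriv γ Q := by
  unfold polarDeriv
  rw [Finset.sum_mul, Finset.mul_sum, ← Finset.sum_add_distrib]
  exact Finset.sum_congr rfl fun q _ => by rw [pderiv_mul]; ring

/-- `D_γ` commutes with scalars. -/
theorem polarDeriv_C_mul (γ : σ → R) (a : R) (P : MvPolynomial σ R) :
    polarDeriv γ (C a * P) = C a * polarDeriv γ P := by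
  rw [polarDeriv_mul, polarDeriv_C, zero_mul, zero_add]

/-- `D_γ` of a finite sum. -/
theorem polarDeriv_sum {ι : Type*} (γ : σ → R) (s : Finset ι) (P : ι → MvPolynomial σ R) :
    polarDeriv γ (∑ i ∈ s, P i) = ∑ i ∈ s, polarDeriv γ (P i) := by
  classical
  induction s using Finset.induction_on with
  | empty => simp
  | insert a s ha ih => rw [Finset.sum_insert ha, Finset.sum_insert ha, polarDeriv_add, ih]

/-- `map φ (D_γ P) = D_{φ ∘ γ} (map φ P)`. -/
theorem map_polarDeriv {S : Type*} [CommSemiring S] (φ : R →+* S) (γ : σ → R) (P : MvPolynomial σ R) :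
    map φ (polarDeriv γ P) = polarDeriv (fun q => φ (γ q)) (map φ P) := by
  simp [polarDeriv, map_sum, pderiv_map]

/-- `(D_γ G)_j = D_γ (G_{j+1})`. -/
theorem homogeneousComponent_polarDeriv (j : ℕ) (γ : σ → R) (G : MvPolynomial σ R) :
    homogeneousComponent j (polarDeriv γ G) = polarDeriv γ (homogeneousComponent (j + 1) G) := by
  simp only [polarDeriv, map_sum, homogeneousComponent_C_mul, homogeneousComponent_pderiv]

/-- `D_γ` lowers the degree of a form by one. -/
theorem IsHomogeneous.polarDeriv {P : MvPolynomial σ R} {m : ℕ} (hP : P.IsHomogeneous m) (γ : σ → R) :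
    (GraphEquations.polarDeriv γ P).IsHomogeneous (m - 1) := by
  show (∑ q, C (γ q) * pderiv q P).IsHomogeneous (m - 1)
  exact IsHomogeneous.sum _ _ _ fun q _ => (hP.pderiv).C_mul _

/-- Evaluating a linear form: `ℓ(x) = Σ_q ℓ_q x_q`. -/
theorem eval_eq_sum_of_isHomogeneous_one {ℓ : MvPolynomial σ R} (h : ℓ.IsHomogeneous 1) (x : σ → R) :
    eval x ℓ = ∑ q, coeff (Finsupp.single q 1) ℓ * x q := by
  have he := h.sum_X_mul_pderiv
  rw [one_smul] at he
  conv_lhs => rw [← he]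
  simp [map_sum, pderiv_eq_C_of_isHomogeneous_one h, mul_comm]

/-- On LINEAR forms `D_γ ℓ` is the constant `ℓ(γ)`: `(D_γ ℓ)(x) = ℓ(γ)`. -/
theorem eval_polarDeriv_of_isHomogeneous_one {ℓ : MvPolynomial σ R} (h : ℓ.IsHomogeneous 1)
    (γ x : σ → R) : eval x (polarDeriv γ ℓ) = eval γ ℓ := by
  rw [eval_eq_sum_of_isHomogeneous_one h]
  simp [polarDeriv, map_sum, pderiv_eq_C_of_isHomogeneous_one h, mul_comm]

/-- **Symmetry of the polar form of a QUADRATIC form**: `(D_γ P)(x) = (D_x P)(γ)`. -/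
theorem eval_polarDeriv_comm {P : MvPolynomial σ R} (h : P.IsHomogeneous 2) (γ x : σ → R) :
    eval x (polarDeriv γ P) = eval γ (polarDeriv x P) := by
  classical
  have hq : ∀ q, (pderiv q P).IsHomogeneous 1 := fun q => h.pderiv
  simp only [polarDeriv, map_sum, map_mul, eval_C, eval_eq_sum_of_isHomogeneous_one (hq _),
    coeff_pderiv, Finset.mul_sum]
  rw [Finset.sum_comm]
  refine Finset.sum_congr rfl fun q _ => Finset.sum_congr rfl fun r _ => ?_
  rw [add_comm (Finsupp.single q 1) (Finsupp.single r 1), Finsupp.single_apply,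
    Finsupp.single_apply]
  by_cases hqr : q = r
  · subst hqr; ring
  · rw [if_neg hqr, if_neg (Ne.symm hqr)]; ring

end polar

/-! ## The derivation `D_μ = Σ_q μ_q(a,b) ∂/∂c_q` on `ℂ[A,B,C]` and its conjugate on `ℂ[A,B][F]` -/

/-- `D_μ u = Σ_q ι(μ_q) ∂u/∂c_q`: the derivative of `u ∈ ℂ[A,B,C]` in the `C`-directions along a
coefficient FIELD `μ : q ↦ μ_q(a,b) ∈ ℂ[A,B]`. -/
def derivC (μ : Fin n × Fin n → MvPolynomial (MatMulVars n) ℂ) (u : MvPolynomial (GraphVars n) ℂ) :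
    MvPolynomial (GraphVars n) ℂ :=
  ∑ q, liftAB n (μ q) * pderiv (Sum.inr q) u

/-- `D_μ` is additive. -/
theorem derivC_add (μ : Fin n × Fin n → MvPolynomial (MatMulVars n) ℂ) (u v : MvPolynomial (GraphVars n) ℂ) :
    derivC μ (u + v) = derivC μ u + derivC μ v := by
  simp [derivC, mul_add, Finset.sum_add_distrib]

/-- `D_μ 0 = 0`. -/
@[simp] theorem derivC_zero (μ : Fin n × Fin n → MvPolynomial (MatMulVars n) ℂ) : derivC μ 0 = 0 := by
  simp [derivC]

/-- Leibniz rule for `D_μ`. -/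
theorem derivC_mul (μ : Fin n × Fin n → MvPolynomial (MatMulVars n) ℂ) (u v : MvPolynomial (GraphVars n) ℂ) :
    derivC μ (u * v) = derivC μ u * v + u * derivC μ v := by
  unfold derivC
  rw [Finset.sum_mul, Finset.mul_sum, ← Finset.sum_add_distrib]
  exact Finset.sum_congr rfl fun q _ => by rw [pderiv_mul]; ring

/-- `∂ι(g)/∂c_q = 0` for `g ∈ ℂ[A,B]`. -/
theorem pderiv_inr_liftAB (q : Fin n × Fin n) (g : MvPolynomial (MatMulVars n) ℂ) :
    pderiv (Sum.inr q) (liftAB n g) = 0 := by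
  induction g using MvPolynomial.induction_on with
  | C c => simp
  | add p r hp hr => rw [map_add, map_add, hp, hr, add_zero]
  | mul_X p v hp =>
    rw [map_mul, liftAB_X, pderiv_mul, hp, zero_mul, zero_add, pderiv_X_of_ne (Sum.inl_ne_inr), mul_zero]

/-- `∂f_{q'}/∂c_q = δ_{qq'}`. -/
theorem pderiv_inr_generator_eq_ite [DecidableEq (Fin n × Fin n)] (q q' : Fin n × Fin n) :
    pderiv (Sum.inr q) (generator n q') = if q' = q then 1 else 0 := by
  classical
  have h0 : pderiv (Sum.inr q) (∑ k : Fin n, X (Sum.inl (Sum.inl (q'.1, k))) *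
      X (Sum.inl (Sum.inr (k, q'.2))) : MvPolynomial (GraphVars n) ℂ) = 0 := by
    rw [map_sum]
    exact Finset.sum_eq_zero fun k _ => by
      rw [pderiv_mul, pderiv_X_of_ne (Sum.inl_ne_inr), pderiv_X_of_ne (Sum.inl_ne_inr)]; ring
  rw [generator, map_sub, h0, sub_zero, pderiv_X]
  simp [Pi.single_apply]

/-- **`Ψ ∘ ∂/∂F_q = ∂/∂c_q ∘ Ψ`**: `a, b` are parameters. -/
theorem substF_pderiv (q : Fin n × Fin n) (G : FPoly n) :
    substF n (pderiv q G) = pderiv (Sum.inr q) (substF n G) := by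
  classical
  induction G using MvPolynomial.induction_on with
  | C g => rw [pderiv_C, map_zero, substF_C, pderiv_inr_liftAB]
  | add p r hp hr => rw [map_add, map_add, hp, hr, map_add, map_add]
  | mul_X p q' hp =>
    rw [pderiv_mul, map_add, map_mul, map_mul, hp, map_mul, substF_X, pderiv_mul,
      pderiv_inr_generator_eq_ite, pderiv_X]
    by_cases h : q' = q
    · subst h; simp
    · simp [h]

/-- **`Ψ(D_μ G) = D_μ Ψ(G)`** with `D_μ = Σ_q μ_q ∂/∂F_q` on `ℂ[A,B][F]`. -/
theorem substF_polarDeriv (μ : Fin n × Fin n → MvPolynomial (MatMulVars n) ℂ) (G : FPoly n) :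
    substF n (polarDeriv μ G) = derivC μ (substF n G) := by
  simp [polarDeriv, derivC, map_sum, substF_pderiv]

/-- **KERNEL-FIELD CRITERION.**  `D_μ u ∈ I ⇔ Σ_q μ_q · (∂G/∂F_q)(a,b;0) = 0` where `u = G(a,b;f)`:
the order-`0` part of `D_μ u` is the pairing of `μ` with the linear part of `G`. -/
theorem derivC_mem_graphIdeal_iff (μ : Fin n × Fin n → MvPolynomial (MatMulVars n) ℂ)
    (u : MvPolynomial (GraphVars n) ℂ) :
    derivC μ u ∈ graphIdeal n ↔ ∑ q, μ q * coeff (Finsupp.single q 1) (liftF n u) = 0 := by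
  have hc : ∀ q, constantCoeff (pderiv q (liftF n u)) = coeff (Finsupp.single q 1) (liftF n u) :=
    fun q => by rw [show constantCoeff (pderiv q (liftF n u)) = coeff 0 (pderiv q (liftF n u)) from rfl,
      coeff_pderiv]; simp
  conv_lhs => rw [← substF_liftF u, ← substF_polarDeriv, substF_mem_graphIdeal_iff]
  simp [polarDeriv, hc]

/-- `D_μ` of an element of `I²`-order `≥ 2`... more generally: if `G_0 = G_1 = 0` then `D_μ Ψ(G) ∈ I`. -/
theorem derivC_substF_mem_graphIdeal {G : FPoly n} (h1 : homogeneousComponent 1 G = 0)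
    (μ : Fin n × Fin n → MvPolynomial (MatMulVars n) ℂ) : derivC μ (substF n G) ∈ graphIdeal n := by
  have h := homogeneousComponent_polarDeriv 0 μ G
  rw [zero_add, h1, polarDeriv_zero, homogeneousComponent_zero, C_eq_zero] at h
  rw [← substF_polarDeriv, substF_mem_graphIdeal_iff]
  exact h

/-- `D_μ` maps `span S` into `span (S ∪ D_μ S)`; precisely: if `S ⊆ S'` and `D_μ S ⊆ S'` then
`D_μ (span S) ⊆ span S'`. -/
theorem derivC_mem_span {S S' : Set (MvPolynomial (GraphVars n) ℂ)}
    (μ : Fin n × Fin n → MvPolynomial (MatMulVars n) ℂ) (hSS' : S ⊆ S')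
    (hD : ∀ t ∈ S, derivC μ t ∈ S') {u : MvPolynomial (GraphVars n) ℂ} (hu : u ∈ Ideal.span S) :
    derivC μ u ∈ Ideal.span S' := by
  induction hu using Submodule.span_induction with
  | mem t ht => exact Ideal.subset_span (hD t ht)
  | zero => rw [derivC_zero]; exact Ideal.zero_mem _
  | add a b _ _ ha hb => rw [derivC_add]; exact Ideal.add_mem _ ha hb
  | smul a t ht hat =>
    rw [smul_eq_mul, derivC_mul]
    exact Ideal.add_mem _ (Ideal.mul_mem_left _ _ (Ideal.span_mono hSS' ht)) (Ideal.mul_mem_left _ _ hat)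

end Summit.MatrixMultiplication.MatrixMultiplication.Theorems.GraphEquations

end
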